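import Literature.NumberTheory.GaloisCohomology.Howard2004.InertLocalPairingSymmetryProofs
import HarnessLib

/-!
# Howard 2004, Lemma 1.5.3: `G_ℚ`-invariance of the local Tate pairing at an inert prime ⇒
# `H¹(K_q, T̄)⁺ ⊥ H¹(K_q, T̄)⁻` and non-degeneracy on each eigenpart (residual level; theorems only)

Topic `NumberTheory/GaloisCohomology/Howard2004`. THEOREMS ONLY: no definition, no named fact, no
instance, no notation, no `sorry`. Cell `pub/bsd-print-x9`, print leaf G87
`Literature.NumberTheory.GaloisCohomology.Howard2004.thm161_dvrKolyvaginBound`; seat `bsd-line-x10b-p1-w5` g8,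
sequel to `InertLocalPairingSymmetryProofs` (dictionary there: `P(s,t) = ē(s, θt)`, `∪_P`, `⟨x, y⟩_q`, `τ_q`).

SOURCE. B. Howard, Compositio Math. **140** (2004) = arXiv:1202.6340, Lemma 1.5.3, proof (p. 10 L10–16):
«By global duality the images of the rightmost arrows are exact orthogonal complements under the
`G_ℚ`-invariant local Tate pairing. Furthermore the action of complex conjugation splits `H¹_f(K_ℓ, T̄)` and
`H¹_s(K_ℓ, T̄)` each into one-dimensional eigenspaces … It follows that `H¹_{F(n)}(K, T̄)^± = H¹_{F^ℓ(n)}(K, T̄)^±`.»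
The sign-by-sign reading needs: the pairing of a `+`-class with a `−`-class VANISHES, i.e. `⟨ , ⟩_q` is
`G_ℚ`-invariant: `⟨τx, τy⟩ = τ·⟨x, y⟩ = ⟨x, y⟩` (τ acts trivially on `H²(K_q, μ) ≅ ℤ/p^k` through THE invariant
map: Serre, *Local class field theory* (Cassels–Fröhlich VI) §1.1, functoriality of `inv`).

THE ONE GALOIS INPUT is taken as a HYPOTHESIS `hGQ`, stated cast-free at the pair of places `(σ q, q)` and read
through an arbitrary additive family `ι_w : H²(K_w, R̄(1)) →+ Z` (`Z` without `2`-torsion; in the application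
`ι_w = inv_w ∘ H²(exp ∘ λ)`, `Z = ℤ/p^k`, `p` odd): for `x, y ∈ H¹(K_{σq}, T̄)`,
`ι_q (τ^pre x ∪_P τ^pre y) = ι_{σq} (x ∪_P y)`, `τ^pre := θ_* ∘ transport_q : H¹(K_{σ q}, T̄) → H¹(K_q, T̄)`.
It is PROVED for the canonical conjugation datum `ConjugationDatum.ofLifts` from
`LocalInvariants.IsConjCompatible` in `InertLocalPairingOfLiftsProofs` (this seat).

WHAT IS PROVED (generic conjugation datum `cd`, inert `q`, `h : σ q = q`):
* `apply_cupProduct_cast` (place-cast bookkeeping), **`apply_cupProduct_thetaH1_transportH1_cast`**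
  (`ι_q (τ_q x ∪_P τ_q y) = ι_q (x ∪_P y)`);
* **`apply_cupProduct_eq_zero_of_eq_of_eq_neg`** / **`apply_localCup_transportH1_cast_eq_zero_of_eq_of_eq_neg`**:
  `τ_q x = x`, `τ_q y = −y` ⇒ `ι_q (x ∪_P y) = 0`, `ι_q ⟨x, y⟩_q = 0 = ι_q ⟨y, x⟩_q`
  (**`H¹(K_q, T̄)⁺ ⊥ H¹(K_q, T̄)⁻`**);
* **`eq_zero_of_forall_eigen_apply_localCup_eq_zero`**: if `ι_q ⟨ , ⟩_q` is left non-degenerate on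
  `H¹(K_q, T̄)` (local Tate duality, e.g. `RelaxedSelmerLagrangianCountProofs.eq_zero_of_forall_localCup_transportH1_cast_eq_zero`)
  and every class is a sum of a `τ_q`-fixed and an anti-fixed class, then an `ε`-eigenclass orthogonal to
  all `ε`-eigenclasses is `0` — local Tate duality restricts to a perfect pairing on each eigenpart (input of
  the (GD-line) count and of `hcross` in Lemma 1.5.3).

NOT HERE: `hGQ` itself (companion file), the eigenLINE structure (H.5(a) at `q`, `«ker(Θ_q ∓ 1)` is a
line»), the decomposition `H¹ = H¹⁺ ⊕ H¹⁻`, Poitou–Tate; `thm161_dvrKolyvaginBound` is NOT proved; no summit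
statement is proved; the Birch–Swinnerton-Dyer conjecture is not proved by any of this.
References: [Howard2004HeegnerKolyvagin] Lemma 1.5.3; [CasselsFrohlichANT1967] Ch. VI §1.1;
[MilneADT2006] I Cor. 2.3; [NeukirchSchmidtWingberg2008] I §5.
-/

set_option autoImplicit false

noncomputable section

open Function NumberField IsDedekindDomain Field CategoryTheory
open scoped NumberField

namespace Literature.NumberTheory.GaloisCohomology.Howard2004

open Literature.NumberTheory.GaloisRepresentations
open Literature.NumberTheory.GaloisRepresentations.DiscreteGaloisModule
open Literature.NumberTheory.EllipticCurves

variable {K : Type} [Field K] [NumberField K] {Nbar : Type} [AddCommGroup Nbar]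
  [TopologicalSpace Nbar] [DiscreteTopology Nbar] {R : Type} [CommRing R] [TopologicalSpace R]
  [DiscreteTopology R] [Module R Nbar] {p : ℕ} [Fact p.Prime] [Algebra ℤ_[p] R]
  {cd : ConjugationDatum K} {ρbar : DiscreteGaloisModule K Nbar}

namespace DualityDatum

/-! ## §4 `G_ℚ`-invariance of the local Tate pairing ⇒ `H¹(K_q, T̄)⁺ ⊥ H¹(K_q, T̄)⁻`

The ONE Galois input, taken as a hypothesis `hGQ` (stated cast-free at the pair of places `(σ v, v)` and
read through an arbitrary additive family `ι_v : H²(K_v, R̄(1)) → Z`, in the application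
`ι_v = inv_v ∘ H²(exp ∘ λ)` with `Z = ℤ/p^k`): for `x, y ∈ H¹(K_{σ v}, T̄)`,
`ι_v (τ_v x ∪_P τ_v y) = ι_{σ v} (x ∪_P y)` where `τ_v = θ_* ∘ transport_v : H¹(K_{σ v}, T̄) → H¹(K_v, T̄)`
— the `G_ℚ`-invariance of the local Tate pairing (conjugation by a lift of `σ` transports the cup
product and THE invariant maps are compatible with it; proved for the canonical conjugation datum from
`LocalInvariants.IsConjCompatible` in the companion file `InertLocalPairingOfLiftsProofs`). -/

section Invariance

variable (Dbar : DualityDatum p cd ρbar R) (A : ResidualTau (R := R) cd ρbar)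
  {Z : Type} [AddCommGroup Z]
  (ι : (w : HeightOneSpectrum (𝓞 K)) → galoisCohomology (Dbar.twistOne.toLocal (Sum.inr w)) 2 →+ Z)

/-- Place cast for a cup product read through `ι`: along `e : v = w`,
`ι_w ((e ▸ x) ∪_P (e ▸ y)) = ι_v (x ∪_P y)`. [cite: Howard2004HeegnerKolyvagin, §1.2 (arXiv p. 6 L54–56: degree-two primes `λ̄ = λ`)] -/
theorem apply_cupProduct_cast {v w : HeightOneSpectrum (𝓞 K)} (e : v = w)
    (x y : galoisCohomology (ρbar.toLocal (Sum.inr v)) 1) :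
    ι w (haveI : CompactSpace (absoluteGaloisGroup (Place.Completion (Sum.inr w : Place K))) :=
        absoluteGaloisGroup_compactSpace _
      (DiscreteGaloisModule.pairing (ρbar.toLocal (Sum.inr w)) (ρbar.toLocal (Sum.inr w))
          (Dbar.twistOne.toLocal (Sum.inr w)) (Dbar.eHom.compl₂ A.θ.toAddMonoidHom)
          (Dbar.thetaPairing_equivariant_toLocal A (Sum.inr w))).cupProduct
        (e ▸ x : galoisCohomology (ρbar.toLocal (Sum.inr w)) 1)
        (e ▸ y : galoisCohomology (ρbar.toLocal (Sum.inr w)) 1)) =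
    ι v (haveI : CompactSpace (absoluteGaloisGroup (Place.Completion (Sum.inr v : Place K))) :=
        absoluteGaloisGroup_compactSpace _
      (DiscreteGaloisModule.pairing (ρbar.toLocal (Sum.inr v)) (ρbar.toLocal (Sum.inr v))
          (Dbar.twistOne.toLocal (Sum.inr v)) (Dbar.eHom.compl₂ A.θ.toAddMonoidHom)
          (Dbar.thetaPairing_equivariant_toLocal A (Sum.inr v))).cupProduct x y) := by
  subst e
  rfl

variable {q : HeightOneSpectrum (𝓞 K)} (h : cd.σ • q = q)
  (hGQ : ∀ x y : galoisCohomology (ρbar.toLocal (Sum.inr (cd.σ • q))) 1,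
    ι q (haveI : CompactSpace (absoluteGaloisGroup (Place.Completion (Sum.inr q : Place K))) :=
        absoluteGaloisGroup_compactSpace _
      (DiscreteGaloisModule.pairing (ρbar.toLocal (Sum.inr q)) (ρbar.toLocal (Sum.inr q))
          (Dbar.twistOne.toLocal (Sum.inr q)) (Dbar.eHom.compl₂ A.θ.toAddMonoidHom)
          (Dbar.thetaPairing_equivariant_toLocal A (Sum.inr q))).cupProduct
        (A.thetaH1 (Sum.inr q) (cd.transportH1 ρbar q x))
        (A.thetaH1 (Sum.inr q) (cd.transportH1 ρbar q y))) =
    ι (cd.σ • q)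
      (haveI : CompactSpace (absoluteGaloisGroup (Place.Completion (Sum.inr (cd.σ • q) : Place K))) :=
        absoluteGaloisGroup_compactSpace _
      (DiscreteGaloisModule.pairing (ρbar.toLocal (Sum.inr (cd.σ • q))) (ρbar.toLocal (Sum.inr (cd.σ • q)))
          (Dbar.twistOne.toLocal (Sum.inr (cd.σ • q))) (Dbar.eHom.compl₂ A.θ.toAddMonoidHom)
          (Dbar.thetaPairing_equivariant_toLocal A (Sum.inr (cd.σ • q)))).cupProduct x y))

include hGQ

/-- **`τ_q`-invariance of `∪_P` read through `ι_q` at an inert prime**: `ι_q (τ_q x ∪_P τ_q y) = ι_q (x ∪_P y)`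
(the hypothesis `hGQ` at `q = σ q`, place cast removed). [cite: Howard2004HeegnerKolyvagin, Lemma 1.5.3 (arXiv p. 10 L10–12: «the `G_ℚ`-invariant local Tate pairing»)] -/
theorem apply_cupProduct_thetaH1_transportH1_cast (x y : galoisCohomology (ρbar.toLocal (Sum.inr q)) 1) :
    ι q (haveI : CompactSpace (absoluteGaloisGroup (Place.Completion (Sum.inr q : Place K))) :=
        absoluteGaloisGroup_compactSpace _
      (DiscreteGaloisModule.pairing (ρbar.toLocal (Sum.inr q)) (ρbar.toLocal (Sum.inr q))
          (Dbar.twistOne.toLocal (Sum.inr q)) (Dbar.eHom.compl₂ A.θ.toAddMonoidHom)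
          (Dbar.thetaPairing_equivariant_toLocal A (Sum.inr q))).cupProduct
        (A.thetaH1 (Sum.inr q) (cd.transportH1 ρbar q
          (h.symm ▸ x : galoisCohomology (ρbar.toLocal (Sum.inr (cd.σ • q))) 1)))
        (A.thetaH1 (Sum.inr q) (cd.transportH1 ρbar q
          (h.symm ▸ y : galoisCohomology (ρbar.toLocal (Sum.inr (cd.σ • q))) 1)))) =
    ι q (haveI : CompactSpace (absoluteGaloisGroup (Place.Completion (Sum.inr q : Place K))) :=
        absoluteGaloisGroup_compactSpace _
      (DiscreteGaloisModule.pairing (ρbar.toLocal (Sum.inr q)) (ρbar.toLocal (Sum.inr q))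
          (Dbar.twistOne.toLocal (Sum.inr q)) (Dbar.eHom.compl₂ A.θ.toAddMonoidHom)
          (Dbar.thetaPairing_equivariant_toLocal A (Sum.inr q))).cupProduct x y) := by
  rw [hGQ, Dbar.apply_cupProduct_cast A ι h.symm x y]

/-- **`H¹(K_q, T̄)⁺ ⊥ H¹(K_q, T̄)⁻` for `∪_P` read through `ι_q`**: if `τ_q x = x`, `τ_q y = −y` then
`ι_q (x ∪_P y) = −ι_q (x ∪_P y)`, so `ι_q (x ∪_P y) = 0` as soon as `Z` has no `2`-torsion (`Z = ℤ/p^k`,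
`p` odd). [cite: Howard2004HeegnerKolyvagin, Lemma 1.5.3 (arXiv p. 10 L10–16: «exact orthogonal complements under the `G_ℚ`-invariant local Tate pairing … one-dimensional eigenspaces»)] -/
theorem apply_cupProduct_eq_zero_of_eq_of_eq_neg (h2 : ∀ z : Z, 2 • z = 0 → z = 0)
    {x y : galoisCohomology (ρbar.toLocal (Sum.inr q)) 1}
    (hx : A.thetaH1 (Sum.inr q) (cd.transportH1 ρbar q
        (h.symm ▸ x : galoisCohomology (ρbar.toLocal (Sum.inr (cd.σ • q))) 1)) = x)
    (hy : A.thetaH1 (Sum.inr q) (cd.transportH1 ρbar q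
        (h.symm ▸ y : galoisCohomology (ρbar.toLocal (Sum.inr (cd.σ • q))) 1)) = -y) :
    ι q (haveI : CompactSpace (absoluteGaloisGroup (Place.Completion (Sum.inr q : Place K))) :=
        absoluteGaloisGroup_compactSpace _
      (DiscreteGaloisModule.pairing (ρbar.toLocal (Sum.inr q)) (ρbar.toLocal (Sum.inr q))
          (Dbar.twistOne.toLocal (Sum.inr q)) (Dbar.eHom.compl₂ A.θ.toAddMonoidHom)
          (Dbar.thetaPairing_equivariant_toLocal A (Sum.inr q))).cupProduct x y) = 0 := by
  haveI : CompactSpace (absoluteGaloisGroup (Place.Completion (Sum.inr q : Place K))) :=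
    absoluteGaloisGroup_compactSpace _
  set P := DiscreteGaloisModule.pairing (ρbar.toLocal (Sum.inr q)) (ρbar.toLocal (Sum.inr q))
    (Dbar.twistOne.toLocal (Sum.inr q)) (Dbar.eHom.compl₂ A.θ.toAddMonoidHom)
    (Dbar.thetaPairing_equivariant_toLocal A (Sum.inr q)) with hP
  have key := Dbar.apply_cupProduct_thetaH1_transportH1_cast A ι h hGQ x y
  rw [hx, hy] at key
  -- `ι (P x (−y)) = −ι (P x y)`
  have hneg : ι q (P.cupProduct x (-y)) = -ι q (P.cupProduct x y) := by
    rw [← map_neg (ι q)]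
    exact congrArg (ι q) ((P.cupProduct x).map_neg y)
  rw [hneg] at key
  -- `−a = a ⇒ 2a = 0 ⇒ a = 0`
  refine h2 _ ?_
  rw [two_nsmul]
  nth_rewrite 1 [← key]
  exact neg_add_cancel _

/-- **`⟨x, y⟩_q` read through `ι_q` vanishes on eigenclasses of opposite signs** (`τ_q x = x`, `τ_q y = −y`):
both `ι_q ⟨x, y⟩_q = 0` and `ι_q ⟨y, x⟩_q = 0`. With `ι_q = inv_q ∘ H²(exp∘λ)` over all readings this is
the orthogonality `H¹(K_q, T̄)⁺ ⊥ H¹(K_q, T̄)⁻` of Howard's local pairing, whence local Tate duality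
restricts to a perfect pairing on each eigenpart (the (GD-line) count of Lemma 1.5.3).
[cite: Howard2004HeegnerKolyvagin, Lemma 1.5.3 (arXiv p. 10 L10–16)] -/
theorem apply_localCup_transportH1_cast_eq_zero_of_eq_of_eq_neg
    (hθ : ∀ x y : Nbar, Dbar.e (A.θ x) (A.θ y) = -Dbar.e x y) (h2 : ∀ z : Z, 2 • z = 0 → z = 0)
    {x y : galoisCohomology (ρbar.toLocal (Sum.inr q)) 1}
    (hx : A.thetaH1 (Sum.inr q) (cd.transportH1 ρbar q
        (h.symm ▸ x : galoisCohomology (ρbar.toLocal (Sum.inr (cd.σ • q))) 1)) = x)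
    (hy : A.thetaH1 (Sum.inr q) (cd.transportH1 ρbar q
        (h.symm ▸ y : galoisCohomology (ρbar.toLocal (Sum.inr (cd.σ • q))) 1)) = -y) :
    ι q (Dbar.localCup (Sum.inr q) x (cd.transportH1 ρbar q
        (h.symm ▸ y : galoisCohomology (ρbar.toLocal (Sum.inr (cd.σ • q))) 1))) = 0 ∧
      ι q (Dbar.localCup (Sum.inr q) y (cd.transportH1 ρbar q
        (h.symm ▸ x : galoisCohomology (ρbar.toLocal (Sum.inr (cd.σ • q))) 1))) = 0 := by
  have h0 := Dbar.apply_cupProduct_eq_zero_of_eq_of_eq_neg A ι h hGQ h2 hx hy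
  refine ⟨?_, ?_⟩
  · rw [Dbar.cupProduct_eq_neg_localCup_transportH1_cast_of_eq_neg A h hy, map_neg, neg_eq_zero] at h0
    exact h0
  · rw [Dbar.localCup_transportH1_cast_comm_of_eq_of_eq_neg A h hθ hx hy, map_neg, neg_eq_zero]
    rw [Dbar.cupProduct_eq_neg_localCup_transportH1_cast_of_eq_neg A h hy, map_neg, neg_eq_zero] at h0
    exact h0

/-- **Non-degeneracy descends to the eigenparts.** If `⟨ , ⟩_q` read through `ι_q` is non-degenerate on
the left on `H¹(K_q, T̄)` (local Tate duality: `ι_q ⟨x, y⟩_q = 0` for all `y` forces `x = 0`) and every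
class decomposes as a sum of a `τ_q`-fixed and a `τ_q`-anti-fixed class (`2 ∈ R̄ˣ`), then a `τ_q`-FIXED
`x` orthogonal to all `τ_q`-fixed classes is `0` (and symmetrically for anti-fixed): local Tate duality
restricts to a perfect pairing on `H¹(K_q, T̄)^± × H¹(K_q, T̄)^±`, the input of the (GD-line) count and
of the cross non-degeneracy `hcross` of Lemma 1.5.3.
[cite: Howard2004HeegnerKolyvagin, Lemma 1.5.3 (arXiv p. 10 L10–16 and L34–40)] -/
theorem eq_zero_of_forall_eigen_apply_localCup_eq_zero
    (hθ : ∀ x y : Nbar, Dbar.e (A.θ x) (A.θ y) = -Dbar.e x y) (h2 : ∀ z : Z, 2 • z = 0 → z = 0)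
    (hnd : ∀ x : galoisCohomology (ρbar.toLocal (Sum.inr q)) 1,
      (∀ y, ι q (Dbar.localCup (Sum.inr q) x (cd.transportH1 ρbar q
        (h.symm ▸ y : galoisCohomology (ρbar.toLocal (Sum.inr (cd.σ • q))) 1))) = 0) → x = 0)
    (hdec : ∀ y : galoisCohomology (ρbar.toLocal (Sum.inr q)) 1,
      ∃ yp ym : galoisCohomology (ρbar.toLocal (Sum.inr q)) 1,
        A.thetaH1 (Sum.inr q) (cd.transportH1 ρbar q
            (h.symm ▸ yp : galoisCohomology (ρbar.toLocal (Sum.inr (cd.σ • q))) 1)) = yp ∧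
          A.thetaH1 (Sum.inr q) (cd.transportH1 ρbar q
            (h.symm ▸ ym : galoisCohomology (ρbar.toLocal (Sum.inr (cd.σ • q))) 1)) = -ym ∧
          y = yp + ym)
    {ε : ℤ} (hε : ε = 1 ∨ ε = -1) {x : galoisCohomology (ρbar.toLocal (Sum.inr q)) 1}
    (hx : A.thetaH1 (Sum.inr q) (cd.transportH1 ρbar q
        (h.symm ▸ x : galoisCohomology (ρbar.toLocal (Sum.inr (cd.σ • q))) 1)) = ε • x)
    (hperp : ∀ y : galoisCohomology (ρbar.toLocal (Sum.inr q)) 1,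
      A.thetaH1 (Sum.inr q) (cd.transportH1 ρbar q
          (h.symm ▸ y : galoisCohomology (ρbar.toLocal (Sum.inr (cd.σ • q))) 1)) = ε • y →
        ι q (Dbar.localCup (Sum.inr q) x (cd.transportH1 ρbar q
          (h.symm ▸ y : galoisCohomology (ρbar.toLocal (Sum.inr (cd.σ • q))) 1))) = 0) :
    x = 0 := by
  refine hnd x fun y => ?_
  obtain ⟨yp, ym, hyp, hym, rfl⟩ := hdec y
  rw [cast_add ρbar h.symm yp ym, map_add, map_add, map_add]
  rcases hε with rfl | rfl
  · rw [one_zsmul] at hx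
    have h1 : ι q (Dbar.localCup (Sum.inr q) x (cd.transportH1 ρbar q
        (h.symm ▸ yp : galoisCohomology (ρbar.toLocal (Sum.inr (cd.σ • q))) 1))) = 0 :=
      hperp yp (by rw [hyp, one_zsmul])
    rw [h1, (Dbar.apply_localCup_transportH1_cast_eq_zero_of_eq_of_eq_neg A ι h hGQ hθ h2 hx hym).1,
      add_zero]
  · rw [neg_one_zsmul] at hx
    have h1 : ι q (Dbar.localCup (Sum.inr q) x (cd.transportH1 ρbar q
        (h.symm ▸ ym : galoisCohomology (ρbar.toLocal (Sum.inr (cd.σ • q))) 1))) = 0 :=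
      hperp ym (by rw [hym, neg_one_zsmul])
    rw [h1, (Dbar.apply_localCup_transportH1_cast_eq_zero_of_eq_of_eq_neg A ι h hGQ hθ h2 hyp hx).2,
      zero_add]

end Invariance


end DualityDatum

end Literature.NumberTheory.GaloisCohomology.Howard2004
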